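import Mathlib
import Summits.NavierStokesRegularity.FluidComputer.TorusShellEnergyBudget
import HarnessLib

/-!
# The EXACT shell energy identity of a Leray–Hopf solution of the periodic Navier–Stokes equations

HONEST FRAMING (cell `ns-blowup`, seat `ns-blowup-circuit` g6, human ruling D-0035): nothing here is a
claim about Navier–Stokes blow-up. WHAT THIS IS NOT: not a regularity criterion, not blow-up evidence.
Part 7b of the `TorusHighBand*` files: for a Leray–Hopf solution `u` on `T^d × [0,T)` (`T > 0`, jointly
measurable `f ∈ L¹(0,T;L²)`, `u₀ ∈ L²`), band edges `M₁ ≤ M₂` and the Fourier shell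
`S v = P_{M₂} v − P_{M₁} v`, the energy of the shell obeys, for every `t ∈ (0,T]`, the IDENTITY
`½‖S u(t)‖² + ν ∫_{(0,t]} ‖∇S u(s)‖₂² ds
   = ½‖S u₀‖² + ∫_{(0,t]} ( [∫⟪u,(u·∇)P_{M₂}u⟫ − ∫⟪u,(u·∇)P_{M₁}u⟫](s) + ∫⟪f(s), S u(s)⟫ ) ds`
(`shell_energy_identity`) — the difference of the tree's level identities
`Torus.IsLerayHopfOn.integral_inner_fourierTruncate_self_eq` (Duchon–Robert/Lions file), an equality
even for WEAK solutions. Slice-wise the bracket is the shell transfer `−∫⟪S u,(u·∇)P_{M₁}u⟫ +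
∫⟪Q_{M₂}u,(u·∇)S u⟫` (`shellTransfer_eq`) with the ceilings of part 7a, and the dissipation lies in
`[4π²ν(M₁²+1), 4π²νM₂²]·‖S u‖²` (`shell_poincare`): a kernel-backed budget for the energy of ANY
Fourier band of a real periodic flow (octave shells of memo `CIRCUIT-OBSTRUCTIONS.md` §E; the «child
band» of pub-fluidc's FC-TRIG transfer-efficiency bookkeeping). No definitions.
-/

noncomputable section

open MeasureTheory Set Filter UnitAddTorus Function
open scoped ENNReal NNReal InnerProductSpace RealInnerProductSpace

namespace Summit.NavierStokesRegularity.FluidComputer.TorusHighBandFluxCeiling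

open Literature.Analysis Literature.Analysis.FunctionSpaces Literature.Analysis.FluidPDE

variable {d : Type*} [Fintype d] [DecidableEq d]

section LerayHopfShell

variable {T ν : ℝ} {f u : ℝ → UnitAddTorus d → EuclideanSpace ℝ d} {u₀ : UnitAddTorus d → EuclideanSpace ℝ d}

/-- **THE SHELL ENERGY IDENTITY of a Leray–Hopf solution of the periodic Navier–Stokes equations.**
For `M₁ ≤ M₂`, `S = P_{M₂} − P_{M₁}` and every `t ∈ (0,T]`:
`½‖S u(t)‖² + ν ∫_{(0,t]} ‖∇S u‖₂² = ½‖S u₀‖² + ∫_{(0,t]} ( [∫⟪u,(u·∇)P₂u⟫ − ∫⟪u,(u·∇)P₁u⟫] + ∫⟪f, S u⟫ )`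
(difference of the two level identities; enstrophy and work split across the shell). [folklore;
cf. Foias–Manley–Rosa–Temam 2001, Ch. V §5.1 (5.13)–(5.14)] -/
theorem shell_energy_identity (hu : FluidPDE.Torus.IsLerayHopfOn T ν f u₀ u) (hT : 0 < T)
    (hfm : AEStronglyMeasurable (Torus.stLift f) (volume.restrict (Ioo 0 T ×ˢ univ)))
    (hf : FluidPDE.Torus.MemLqLp 1 2 f (Ioo 0 T)) (hu₀ : MemLp u₀ 2 volume) {M₁ M₂ : ℕ} (h : M₁ ≤ M₂)
    {t : ℝ} (ht : t ∈ Ioc 0 T) :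
    2⁻¹ * (∫ x, ‖Torus.fourierTruncate M₂ (u t) x - Torus.fourierTruncate M₁ (u t) x‖ ^ 2) +
        ν * ∫ s in Ioc 0 t, (Torus.eGradNormSq
          (Torus.fourierTruncate M₂ (u s) - Torus.fourierTruncate M₁ (u s))).toReal =
      2⁻¹ * (∫ x, ‖Torus.fourierTruncate M₂ u₀ x - Torus.fourierTruncate M₁ u₀ x‖ ^ 2) +
        ∫ s in Ioc 0 t, (((∫ x, ⟪u s x, Torus.convect (u s) (Torus.fourierTruncate M₂ (u s)) x⟫) -
            ∫ x, ⟪u s x, Torus.convect (u s) (Torus.fourierTruncate M₁ (u s)) x⟫) +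
          ∫ x, ⟪f s x, Torus.fourierTruncate M₂ (u s) x - Torus.fourierTruncate M₁ (u s) x⟫) := by
  classical
  set P₁ : ℝ → UnitAddTorus d → EuclideanSpace ℝ d := fun s => Torus.fourierTruncate M₁ (u s) with hP₁
  set P₂ : ℝ → UnitAddTorus d → EuclideanSpace ℝ d := fun s => Torus.fourierTruncate M₂ (u s) with hP₂
  have hle : volume.restrict (Ioo 0 t) ≤ volume.restrict (Ioo 0 T) :=
    Measure.restrict_mono (Ioo_subset_Ioo le_rfl ht.2) le_rfl
  have hmem : ∀ s ∈ Icc 0 T, MemLp (u s) 2 volume := hu.memLp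
  have hut : MemLp (u t) 2 volume := hmem t ⟨ht.1.le, ht.2⟩
  -- ### the two level identities with their integrability
  obtain ⟨hΦ₂, hId₂⟩ := hu.integral_inner_fourierTruncate_self_eq hT hfm hf hu₀ M₂ ht
  obtain ⟨hΦ₁, hId₁⟩ := hu.integral_inner_fourierTruncate_self_eq hT hfm hf hu₀ M₁ ht
  have hG₂ := (hu.tendsto_setIntegral_toReal_eGradNormSq_fourierTruncate ht).1 M₂
  have hG₁ := (hu.tendsto_setIntegral_toReal_eGradNormSq_fourierTruncate ht).1 M₁
  have hW₂ := (hu.tendsto_setIntegral_work_fourierTruncate hfm hf ht).1 M₂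
  have hW₁ := (hu.tendsto_setIntegral_work_fourierTruncate hfm hf ht).1 M₁
  have hfs2 : ∀ᵐ s ∂(volume.restrict (Ioc 0 t)), MemLp (f s) 2 volume := by
    have h2 : ∀ᵐ s ∂(volume.restrict (Ioo 0 t)), MemLp (f s) 2 volume := ae_mono hle hf.1
    rwa [Measure.restrict_congr_set Ioo_ae_eq_Ioc] at h2
  -- ### the splits of the two fluxes (a.e. on `(0,t]`)
  have hsplit : ∀ M : ℕ, ∀ᵐ s ∂(volume.restrict (Ioc 0 t)),
      (∫ x, (⟪u s x, Torus.convect (u s) (Torus.fourierTruncate M (u s)) x⟫ +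
          ν * ⟪u s x, Torus.laplacian (Torus.fourierTruncate M (u s)) x⟫ +
          ⟪f s x, Torus.fourierTruncate M (u s) x⟫)) =
        (∫ x, ⟪u s x, Torus.convect (u s) (Torus.fourierTruncate M (u s)) x⟫) -
          ν * (Torus.eGradNormSq (Torus.fourierTruncate M (u s))).toReal +
          ∫ x, ⟪f s x, Torus.fourierTruncate M (u s) x⟫ := by
    intro M
    filter_upwards [hfs2, ae_restrict_mem measurableSet_Ioc] with s hfs' hs
    exact FluidPDE.Torus.flux_fourierTruncate_self_split (hmem s ⟨hs.1.le, hs.2.trans ht.2⟩)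
      (hfs'.integrable one_le_two) ν M
  -- convective fluxes are integrable
  have hC : ∀ M : ℕ,
      IntegrableOn (fun s => ∫ x, (⟪u s x, Torus.convect (u s) (Torus.fourierTruncate M (u s)) x⟫ +
          ν * ⟪u s x, Torus.laplacian (Torus.fourierTruncate M (u s)) x⟫ +
          ⟪f s x, Torus.fourierTruncate M (u s) x⟫)) (Ioc 0 t) →
      IntegrableOn (fun s => (Torus.eGradNormSq (Torus.fourierTruncate M (u s))).toReal) (Ioc 0 t) →
      IntegrableOn (fun s => ∫ x, ⟪f s x, Torus.fourierTruncate M (u s) x⟫) (Ioc 0 t) →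
      IntegrableOn (fun s => ∫ x, ⟪u s x, Torus.convect (u s) (Torus.fourierTruncate M (u s)) x⟫)
        (Ioc 0 t) := by
    intro M hΦ hG hW
    refine ((hΦ.add (hG.const_mul ν)).sub hW).congr ?_
    filter_upwards [hsplit M] with s hs
    simp only [Pi.add_apply, Pi.sub_apply]
    rw [hs]; ring
  have hC₂ := hC M₂ hΦ₂ hG₂ hW₂
  have hC₁ := hC M₁ hΦ₁ hG₁ hW₁
  -- each flux integral splits
  have hIdM : ∀ M : ℕ,
      IntegrableOn (fun s => ∫ x, ⟪u s x, Torus.convect (u s) (Torus.fourierTruncate M (u s)) x⟫)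
        (Ioc 0 t) →
      IntegrableOn (fun s => (Torus.eGradNormSq (Torus.fourierTruncate M (u s))).toReal) (Ioc 0 t) →
      IntegrableOn (fun s => ∫ x, ⟪f s x, Torus.fourierTruncate M (u s) x⟫) (Ioc 0 t) →
      ∫ s in Ioc 0 t, (∫ x, (⟪u s x, Torus.convect (u s) (Torus.fourierTruncate M (u s)) x⟫ +
          ν * ⟪u s x, Torus.laplacian (Torus.fourierTruncate M (u s)) x⟫ +
          ⟪f s x, Torus.fourierTruncate M (u s) x⟫)) =
        (∫ s in Ioc 0 t, ∫ x, ⟪u s x, Torus.convect (u s) (Torus.fourierTruncate M (u s)) x⟫) -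
          ν * (∫ s in Ioc 0 t, (Torus.eGradNormSq (Torus.fourierTruncate M (u s))).toReal) +
          ∫ s in Ioc 0 t, ∫ x, ⟪f s x, Torus.fourierTruncate M (u s) x⟫ := by
    intro M hCM hG hW
    have hG' : Integrable (fun s => ν * (Torus.eGradNormSq (Torus.fourierTruncate M (u s))).toReal)
        (volume.restrict (Ioc 0 t)) := hG.const_mul ν
    have hW' : Integrable (fun s => ∫ x, ⟪f s x, Torus.fourierTruncate M (u s) x⟫)
        (volume.restrict (Ioc 0 t)) := hW
    have h1 : Integrable (fun s => (∫ x, ⟪u s x, Torus.convect (u s) (Torus.fourierTruncate M (u s)) x⟫) -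
        ν * (Torus.eGradNormSq (Torus.fourierTruncate M (u s))).toReal) (volume.restrict (Ioc 0 t)) :=
      hCM.sub hG'
    rw [integral_congr_ae (hsplit M), integral_add h1 hW', integral_sub hCM hG', integral_const_mul]
  have hS₂ := hIdM M₂ hC₂ hG₂ hW₂
  have hS₁ := hIdM M₁ hC₁ hG₁ hW₁
  -- ### the dissipation splits across the shell, slice-wise on `(0,t]`
  have hGsplit : ∀ s ∈ Ioc 0 t, (Torus.eGradNormSq (P₂ s)).toReal =
      (Torus.eGradNormSq (P₁ s)).toReal + (Torus.eGradNormSq (P₂ s - P₁ s)).toReal := by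
    intro s hs
    have hint : Integrable (u s) volume := (hmem s ⟨hs.1.le, hs.2.trans ht.2⟩).integrable one_le_two
    simp only [hP₁, hP₂]
    rw [eGradNormSq_fourierTruncate_eq_add_shell hint h, ENNReal.toReal_add
      (Torus.eGradNormSq_lt_top (Torus.isSmooth_fourierTruncate M₁ _)).ne
      (Torus.eGradNormSq_lt_top ((Torus.isSmooth_fourierTruncate M₂ _).sub
        (Torus.isSmooth_fourierTruncate M₁ _))).ne]
  have hGSint : IntegrableOn (fun s => (Torus.eGradNormSq (P₂ s - P₁ s)).toReal) (Ioc 0 t) := by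
    have hG₁' : Integrable (fun s => (Torus.eGradNormSq (P₁ s)).toReal) (volume.restrict (Ioc 0 t)) := hG₁
    have hG₂' : Integrable (fun s => (Torus.eGradNormSq (P₂ s)).toReal) (volume.restrict (Ioc 0 t)) := hG₂
    refine (hG₂'.sub hG₁').congr ?_
    filter_upwards [ae_restrict_mem measurableSet_Ioc] with s hs
    simp only [Pi.sub_apply]
    rw [hGsplit s hs]; ring
  have hGS : ∫ s in Ioc 0 t, (Torus.eGradNormSq (P₂ s)).toReal =
      (∫ s in Ioc 0 t, (Torus.eGradNormSq (P₁ s)).toReal) +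
        ∫ s in Ioc 0 t, (Torus.eGradNormSq (P₂ s - P₁ s)).toReal := by
    have hG₁' : Integrable (fun s => (Torus.eGradNormSq (P₁ s)).toReal) (volume.restrict (Ioc 0 t)) := hG₁
    rw [← integral_add hG₁' hGSint]
    exact setIntegral_congr_fun measurableSet_Ioc fun s hs => hGsplit s hs
  -- ### the work splits across the shell
  have hWS : (∫ s in Ioc 0 t, ∫ x, ⟪f s x, P₂ s x⟫) - (∫ s in Ioc 0 t, ∫ x, ⟪f s x, P₁ s x⟫) =
      ∫ s in Ioc 0 t, ∫ x, ⟪f s x, P₂ s x - P₁ s x⟫ := by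
    have hW₁' : Integrable (fun s => ∫ x, ⟪f s x, P₁ s x⟫) (volume.restrict (Ioc 0 t)) := hW₁
    have hW₂' : Integrable (fun s => ∫ x, ⟪f s x, P₂ s x⟫) (volume.restrict (Ioc 0 t)) := hW₂
    rw [← integral_sub hW₂' hW₁']
    refine integral_congr_ae ?_
    filter_upwards [hfs2] with s hfs'
    rw [← integral_sub (FluidPDE.integrable_inner_of_memLp_two hfs' (Torus.memLp_fourierTruncate M₂ (u s) 2))
      (FluidPDE.integrable_inner_of_memLp_two hfs' (Torus.memLp_fourierTruncate M₁ (u s) 2))]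
    refine integral_congr_ae (ae_of_all _ fun x => ?_)
    simp only [hP₁, hP₂, inner_sub_right]
  have hWSint : IntegrableOn (fun s => ∫ x, ⟪f s x, P₂ s x - P₁ s x⟫) (Ioc 0 t) := by
    have hW₁' : Integrable (fun s => ∫ x, ⟪f s x, P₁ s x⟫) (volume.restrict (Ioc 0 t)) := hW₁
    have hW₂' : Integrable (fun s => ∫ x, ⟪f s x, P₂ s x⟫) (volume.restrict (Ioc 0 t)) := hW₂
    refine (hW₂'.sub hW₁').congr ?_
    filter_upwards [hfs2] with s hfs'
    simp only [Pi.sub_apply]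
    rw [← integral_sub (FluidPDE.integrable_inner_of_memLp_two hfs' (Torus.memLp_fourierTruncate M₂ (u s) 2))
      (FluidPDE.integrable_inner_of_memLp_two hfs' (Torus.memLp_fourierTruncate M₁ (u s) 2))]
    refine integral_congr_ae (ae_of_all _ fun x => ?_)
    simp only [hP₁, hP₂, inner_sub_right]
  -- ### Pythagoras across the shell at `t` and for the datum
  have hPy : ∀ {w : UnitAddTorus d → EuclideanSpace ℝ d}, MemLp w 2 volume →
      (∫ x, ⟪Torus.fourierTruncate M₂ w x, Torus.fourierTruncate M₂ w x⟫) -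
        (∫ x, ⟪Torus.fourierTruncate M₁ w x, Torus.fourierTruncate M₁ w x⟫) =
        ∫ x, ‖Torus.fourierTruncate M₂ w x - Torus.fourierTruncate M₁ w x‖ ^ 2 := by
    intro w hw
    have e2 : ∫ x, ⟪Torus.fourierTruncate M₂ w x, Torus.fourierTruncate M₂ w x⟫ =
        ∫ x, ‖Torus.fourierTruncate M₂ w x‖ ^ 2 :=
      integral_congr_ae (ae_of_all _ fun x => real_inner_self_eq_norm_sq _)
    have e1 : ∫ x, ⟪Torus.fourierTruncate M₁ w x, Torus.fourierTruncate M₁ w x⟫ =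
        ∫ x, ‖Torus.fourierTruncate M₁ w x‖ ^ 2 :=
      integral_congr_ae (ae_of_all _ fun x => real_inner_self_eq_norm_sq _)
    rw [e2, e1, integral_norm_sq_fourierTruncate_eq_add_shell hw h]; ring
  have hPt := hPy hut
  have hP0 := hPy hu₀
  -- ### the right-hand side integral splits
  have hRHS : ∫ s in Ioc 0 t, (((∫ x, ⟪u s x, Torus.convect (u s) (P₂ s) x⟫) -
        ∫ x, ⟪u s x, Torus.convect (u s) (P₁ s) x⟫) + ∫ x, ⟪f s x, P₂ s x - P₁ s x⟫) =
      ((∫ s in Ioc 0 t, ∫ x, ⟪u s x, Torus.convect (u s) (P₂ s) x⟫) -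
        ∫ s in Ioc 0 t, ∫ x, ⟪u s x, Torus.convect (u s) (P₁ s) x⟫) +
        ∫ s in Ioc 0 t, ∫ x, ⟪f s x, P₂ s x - P₁ s x⟫ := by
    have hC₁' : Integrable (fun s => ∫ x, ⟪u s x, Torus.convect (u s) (P₁ s) x⟫)
        (volume.restrict (Ioc 0 t)) := hC₁
    have hC₂' : Integrable (fun s => ∫ x, ⟪u s x, Torus.convect (u s) (P₂ s) x⟫)
        (volume.restrict (Ioc 0 t)) := hC₂
    have h12 : Integrable (fun s => (∫ x, ⟪u s x, Torus.convect (u s) (P₂ s) x⟫) -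
        ∫ x, ⟪u s x, Torus.convect (u s) (P₁ s) x⟫) (volume.restrict (Ioc 0 t)) := hC₂'.sub hC₁'
    rw [integral_add h12 hWSint, integral_sub hC₂' hC₁']
  -- ### assemble
  rw [hRHS]
  simp only [hP₁, hP₂] at hS₂ hS₁ hGS hWS hPt hP0 ⊢
  rw [hS₂] at hId₂
  rw [hS₁] at hId₁
  have hνGS : ν * (∫ s in Ioc 0 t, (Torus.eGradNormSq (Torus.fourierTruncate M₂ (u s))).toReal) =
      ν * (∫ s in Ioc 0 t, (Torus.eGradNormSq (Torus.fourierTruncate M₁ (u s))).toReal) +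
        ν * ∫ s in Ioc 0 t, (Torus.eGradNormSq
          (Torus.fourierTruncate M₂ (u s) - Torus.fourierTruncate M₁ (u s))).toReal := by
    rw [hGS, mul_add]
  linarith [hId₂, hId₁, hνGS, hWS, hPt, hP0]

end LerayHopfShell

end Summit.NavierStokesRegularity.FluidComputer.TorusHighBandFluxCeiling
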